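import Literature.NumberTheory.EllipticCurves.Kato2004.IwasawaH1LayerNormProofs
import Literature.NumberTheory.EllipticCurves.Kato2004.IwasawaH1ReductionSeparated
import Literature.NumberTheory.EllipticCurves.Kato2004.IntegralH1FiniteProofs
import Literature.NumberTheory.EllipticCurves.Kato2004.IwasawaH2Descent
import Literature.NumberTheory.EllipticCurves.IwasawaAlgebraCompactNakayamaProofs
import Literature.NumberTheory.GaloisRepresentations.ConjugationDescent
import Mathlib.Algebra.CharP.Lemmas
import HarnessLib

/-!
# Kato 2004 (Astérisque 295) (12.2.1) for `𝐇¹_Γ(T_pW)`: the pinned Iwasawa cohomology is a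
# finitely generated `Λ`-module AS SOON AS `proj₀` is injective modulo `T` ((14.14.1)) — and it is
# unconditionally `(p, T)`-separated

Topic `NumberTheory/EllipticCurves`, sub-directory `Kato2004` (namespace = path). Cell `bsd-cn100`,
prover seat `bsd-cn100-transfer-2` (g8). `Proofs`-style file: theorems only (no definition, no
named fact, no `sorry`, no instance).  Bears on the (12.2.1) clause `Module.Finite Λ I.H` of the
named fact `Kato2004.thm12_4` (conjunct of `stub_refereedInputs` of the lines `kato-zeta-perrin-riou`,
stmt-BirchSwinnertonDyer-19080 / -19160; binder of `Kato2004.thm17_4_skeleton`), on the field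
`finite_H` of `Kato2004.exists_memberHullInputs` (cell `bsd-potss`, item 19659) and on the K6 road
(cell `bsd-smallim`).  Cell `bsd-potss` recorded the road "(12.2.1) `finite_H` needs `ι_injective`
(14.14.1) + `H¹(ℤ[1/p], T)` f.g. + topological Nakayama" (FINDING-19196-rkm-g7); the second input is
the tree theorem `module_finite_integralH1_layerZero` (seat `bsd-cn100-s2-c3` g10), the third is
`IwasawaAlgebraCompactNakayamaProofs`; this file supplies the separatedness and assembles.

## What is proved (every `W/ℚ` elliptic, every prime `p`, every `ℤ_p`-extension datum `κ`, every
`γ ∈ Γ_ℚ`, every pin `I : IwasawaH1Data W p κ γ`; NO cyclotomic / generator hypothesis)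

* `ZpExtension.pow_prime_pow_mem_layerSubgroup` — `γ^{p^n} ∈ Γ_n` for every `γ`.
* `IwasawaH1Data.proj_one_add_X_pow_prime_pow_smul` — `ω_n = (1+T)^{p^n} − 1` kills the `n`-th
  layer: `proj n ((1+T)^{p^n} • y) = proj n y` (`(1+T)^{p^n}` acts as `conj_{γ^{p^n}}`, trivial on
  `H¹(Γ_n, ·)`).
* `IwasawaH1Data.exists_proj_X_pow_prime_pow_smul` — `T^{p^n} ≡ ω_n (mod p)` in `Λ`
  (`exists_add_pow_prime_pow_eq`), so `proj n (T^{p^n} • y) ∈ p · H¹(ℚ_n, T_pW)`, and by induction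
  `proj n (T^{p^n j} • y) ∈ p^j · H¹(ℚ_n, T_pW)` (`exists_proj_X_pow_mul_smul`).
* **`IwasawaH1Data.eq_zero_of_forall_exists_X_pow_add_C_pow`** — `𝐇¹_Γ(T_pW)` is
  `(p, T)`-SEPARATED: `x ∈ T^k 𝐇¹ + p^k 𝐇¹` for all `k` ⟹ `x = 0` (each `proj n x` is then
  `p`-divisible, hence `0` by the tree's `eq_zero_of_forall_mem_pow_smul`, Rubin B.2.3; then
  `proj_injective`).  Unconditional.
* **`IwasawaH1Data.module_finite_of_proj_zero_injective`** — if (α) `proj₀ x = 0 ⟹ x ∈ T·𝐇¹_Γ`,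
  then `𝐇¹_Γ(T_pW)` is a finitely generated `Λ`-module: `𝐇¹_Γ/T ↪ H¹(ℤ[1/p], T_pW)` (f.g. over the
  noetherian `ℤ_p`, `module_finite_integralH1_layerZero`) gives a finite `s` with
  `𝐇¹_Γ = ⟨s⟩_Λ + T·𝐇¹_Γ`, and compact Nakayama (separated form) concludes.  Corollary
  `IwasawaH1Data.module_finite_of_nonempty_iwasawaH2Data`: a descent package (which carries (α),
  `IwasawaH2Data.proj_zero_eq_zero_iff_mem_TSubmodule`) gives (12.2.1) for `𝐇¹_Γ`.

HONEST FRAMING.  (α) is NOT proved here (Kato (14.14.1) injectivity = the `Λ`-adic long exact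
sequence; claimed by seats `bsd-cn100-transfer` g12 / `bsd-potss-rkm` g8).  The rank-one and
freeness clauses of Thm. 12.4 (2)(3) are untouched.  Nothing about Kato's `𝐇²`, the main
conjecture, the cruxes of `CongruentShaFreeCut` / `MordellShaFreeCut`, or BSD is advanced.

## References

* K. Kato, Astérisque 295 (2004), §12.2 (12.2.1) (p. 220), §13.8 (p. 228), §14.14 (14.14.1)
  (p. 243). [Kato2004Asterisque]
* L. C. Washington, *Introduction to Cyclotomic Fields* (1997), Lemma 13.16; §13.1.
  [Washington1997]
* K. Rubin, *Euler Systems* (2000), App. B Prop. B.2.3. [Rubin2000]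
-/

noncomputable section

open Field
open Literature.NumberTheory.GaloisRepresentations
open Literature.NumberTheory.EllipticCurves Literature.NumberTheory.EllipticCurves.Kato2004
open Literature.NumberTheory.EllipticCurves.Kato2004.EulerSystemValues
open Literature.NumberTheory.EllipticCurves.IwasawaAlgebra

/-! ## §1 `γ^{p^n} ∈ Γ_n` for every `γ` -/

namespace Literature.NumberTheory.EllipticCurves.ZpExtension

/-- For every `γ ∈ Γ_K` and every `n`, `γ^{p^n}` lies in the `n`-th layer subgroup
`Γ_n = κ⁻¹(p^n ℤ_p)` (`κ(γ^{p^n}) = p^n · κ(γ)`). [cite: Washington1997, §13.1] -/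
theorem pow_prime_pow_mem_layerSubgroup {K : Type*} [Field K] {p : ℕ} [Fact p.Prime]
    (κ : ZpExtension K p) (γ : absoluteGaloisGroup K) (n : ℕ) :
    γ ^ (p ^ n) ∈ κ.layerSubgroup n := by
  rw [ZpExtension.mem_layerSubgroup, map_pow, toAdd_pow, nsmul_eq_mul, Nat.cast_pow]
  exact Dvd.intro _ rfl

end Literature.NumberTheory.EllipticCurves.ZpExtension

namespace Literature.NumberTheory.EllipticCurves.Kato2004

variable {W : WeierstrassCurve ℚ} [W.IsElliptic] {p : ℕ} [Fact p.Prime]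
  [ContinuousSMul ℤ_[p] (W.tateModule p)] {κ : ZpExtension ℚ p} {γ : absoluteGaloisGroup ℚ}
  (I : IwasawaH1Data W p κ γ)

namespace IwasawaH1Data

/-! ## §2 `ω_n` kills the `n`-th layer; `T^{p^n} ≡ ω_n (mod p)` -/

/-- **`ω_n = (1+T)^{p^n} − 1` kills the `n`-th layer**: `proj n ((1+T)^{p^n} • y) = proj n y`, since
`(1+T)^{p^n}` acts on `H¹(Γ_n, T_pW)` as `conj_{γ^{p^n}}` (tree `proj_one_add_X_pow_smul`) and
`γ^{p^n} ∈ Γ_n` acts trivially on `H¹(Γ_n, ·)`. [cite: Kato2004Asterisque, §12.2 (p. 220)] -/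
theorem proj_one_add_X_pow_prime_pow_smul (n : ℕ) (y : I.H) :
    I.proj n (((1 + PowerSeries.X : IwasawaAlgebra p) ^ (p ^ n)) • y) = I.proj n y := by
  rw [IwasawaH1LayerNorm.proj_one_add_X_pow_smul I,
    conjMap_eq_self_of_mem_one _ _ (ZpExtension.pow_prime_pow_mem_layerSubgroup κ γ n)]

/-- **`proj n (T^{p^n} • y) ∈ p · H¹(ℚ_n, T_pW)`, uniformly in `y`**: `T^{p^n} = ω_n − p·T·r` in `Λ`
(`(1+T)^{p^n} = 1 + T^{p^n} + p·T·r`, Mathlib `exists_add_pow_prime_pow_eq`), `ω_n` kills the layer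
and constants act through `ℤ_p`. [cite: Kato2004Asterisque, §12.2 (p. 220) and §13.8 (p. 228)] -/
theorem exists_proj_X_pow_prime_pow_smul (n : ℕ) :
    ∃ r : IwasawaAlgebra p, ∀ y : I.H,
      I.proj n (((PowerSeries.X : IwasawaAlgebra p) ^ (p ^ n)) • y) = (p : ℤ_[p]) • I.proj n (r • y) := by
  have hp : p.Prime := Fact.out
  obtain ⟨r, hr⟩ := exists_add_pow_prime_pow_eq hp (1 : IwasawaAlgebra p) PowerSeries.X n
  refine ⟨-(PowerSeries.X * r), fun y => ?_⟩
  have hX : (PowerSeries.X : IwasawaAlgebra p) ^ (p ^ n) =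
      (1 + PowerSeries.X) ^ (p ^ n) - 1 - PowerSeries.C (p : ℤ_[p]) * (PowerSeries.X * r) := by
    rw [hr, one_pow, map_natCast]; ring
  rw [hX, sub_smul, sub_smul, one_smul, map_sub, map_sub, I.proj_one_add_X_pow_prime_pow_smul,
    sub_self, zero_sub, mul_smul, I.proj_C_smul, neg_smul, map_neg, smul_neg]

/-- **`proj n (T^{p^n j} • y) ∈ p^j · H¹(ℚ_n, T_pW)`** (induction on `j`).
[cite: Kato2004Asterisque, §12.2 (p. 220) and §13.8 (p. 228)] -/
theorem exists_proj_X_pow_mul_smul (n j : ℕ) (y : I.H) :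
    ∃ w : H1 (tateRep W p) (κ.layerSubgroup n),
      I.proj n (((PowerSeries.X : IwasawaAlgebra p) ^ (p ^ n * j)) • y) = ((p : ℤ_[p]) ^ j) • w := by
  obtain ⟨r, hr⟩ := I.exists_proj_X_pow_prime_pow_smul n
  induction j generalizing y with
  | zero => exact ⟨I.proj n y, by rw [mul_zero, pow_zero, one_smul, pow_zero, one_smul]⟩
  | succ j ih =>
    obtain ⟨w, hw⟩ := ih (r • y)
    refine ⟨w, ?_⟩
    rw [Nat.mul_succ, pow_add, mul_comm, mul_smul, hr, smul_smul r, mul_comm r, ← smul_smul, hw,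
      smul_smul, ← pow_succ']

/-! ## §3 `𝐇¹_Γ(T_pW)` is `(p, T)`-separated (unconditional) -/

/-- **`⋂_k (T^k 𝐇¹_Γ + p^k 𝐇¹_Γ) = 0`.**  If `x ∈ 𝐇¹_Γ(T_pW)` can be written `x = T^k y_k + p^k z_k`
for every `k`, then `x = 0`: for each layer `n` and each `j`, taking `k = p^n j` shows
`proj n x ∈ p^j H¹(ℚ_n, T_pW)` (§2), so `proj n x = 0` by the separatedness of `H¹(ℚ_n, T_pW)`
(`eq_zero_of_forall_mem_pow_smul`, Rubin B.2.3), and `x = 0` by `proj_injective`.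
[cite: Rubin2000, App. B Prop. B.2.3] [cite: Kato2004Asterisque, §12.2 (p. 220)] -/
theorem eq_zero_of_forall_exists_X_pow_add_C_pow (x : I.H)
    (hx : ∀ k : ℕ, ∃ y z : I.H, (PowerSeries.X : IwasawaAlgebra p) ^ k • y +
      PowerSeries.C ((p : ℤ_[p]) ^ k) • z = x) : x = 0 := by
  have hp : p.Prime := Fact.out
  refine I.ext_of_proj fun n => ?_
  rw [map_zero]
  refine eq_zero_of_forall_mem_pow_smul W p (κ.layerSubgroup n) _ fun j => ?_
  obtain ⟨y, z, hyz⟩ := hx (p ^ n * j)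
  obtain ⟨w, hw⟩ := I.exists_proj_X_pow_mul_smul n j y
  have hj : j ≤ p ^ n * j := Nat.le_mul_of_pos_left j (pow_pos hp.pos n)
  refine ⟨w + ((p : ℤ_[p]) ^ (p ^ n * j - j)) • I.proj n z, ?_⟩
  rw [← hyz, map_add, hw, I.proj_C_smul, smul_add, smul_smul, pow_mul_pow_sub _ hj]

/-! ## §4 (12.2.1) for `𝐇¹_Γ(T_pW)` from (14.14.1)-injectivity -/

/-- **Kato (12.2.1) for `𝐇¹_Γ(T_pW)` ⟸ (α).**  If `proj₀ x = 0 ⟹ x ∈ T·𝐇¹_Γ` for all `x` (the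
injectivity half of (14.14.1) on the pin), then `𝐇¹_Γ(T_pW) = I.H` is a finitely generated
`Λ`-module: the image of `proj₀` lies in `H¹(ℤ[1/p], T_pW)`, finitely generated over the noetherian
`ℤ_p` (`module_finite_integralH1_layerZero`), so lifts `s` of finitely many `ℤ_p`-generators of the
image satisfy `𝐇¹_Γ = ⟨s⟩_Λ + T·𝐇¹_Γ` by (α); conclude by compact Nakayama in separated form
(`module_finite_of_separated_of_forall_exists_sub_X_smul_mem_span`, §3).
[cite: Kato2004Asterisque, §12.2 (12.2.1) (p. 220) and §14.14 (14.14.1) (p. 243)]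
[cite: Washington1997, Lemma 13.16] -/
theorem module_finite_of_proj_zero_injective
    (hα : ∀ x : I.H, I.proj 0 x = 0 → x ∈ TSubmodule p I.H) :
    Module.Finite (IwasawaAlgebra p) I.H := by
  classical
  let A := integralH1 (tateRep W p) p (κ.layerSubgroup 0)
  haveI : Module.Finite ℤ_[p] ↥A := module_finite_integralH1_layerZero W p κ
  haveI : IsNoetherian ℤ_[p] ↥A := isNoetherian_of_isNoetherianRing_of_finite ℤ_[p] _
  -- the image of `proj₀`, a `ℤ_p`-submodule of `A`
  let P : Submodule ℤ_[p] ↥A :=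
    { carrier := {a | ∃ x : I.H, I.proj 0 x = (a : H1 (tateRep W p) (κ.layerSubgroup 0))}
      zero_mem' := ⟨0, by rw [map_zero, ZeroMemClass.coe_zero]⟩
      add_mem' := fun {a b} ⟨x, hx⟩ ⟨y, hy⟩ => ⟨x + y, by rw [map_add, hx, hy, AddMemClass.coe_add]⟩
      smul_mem' := fun c a ⟨x, hx⟩ =>
        ⟨PowerSeries.C c • x, by rw [I.proj_C_smul, hx, SetLike.val_smul]⟩ }
  obtain ⟨u, hu⟩ : P.FG := IsNoetherian.noetherian P
  -- lifts of the generators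
  have hlift : ∀ b : ↥A, b ∈ u → ∃ x : I.H, I.proj 0 x = (b : H1 (tateRep W p) (κ.layerSubgroup 0)) :=
    fun b hb => by
      have h : b ∈ P := hu ▸ Submodule.subset_span hb
      exact h
  choose! g hg using hlift
  refine module_finite_of_separated_of_forall_exists_sub_X_smul_mem_span
    (I.eq_zero_of_forall_exists_X_pow_add_C_pow) (u.image g) fun x => ?_
  -- `proj₀ x` is a `ℤ_p`-combination of the generators
  have hxP : (⟨I.proj 0 x, I.proj_mem 0 x⟩ : ↥A) ∈ Submodule.span ℤ_[p] (u : Set ↥A) := by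
    rw [hu]; exact ⟨x, rfl⟩
  obtain ⟨f, -, hf⟩ := Submodule.mem_span_finset.mp hxP
  -- the corresponding `Λ`-combination of the lifts has the same `proj₀`
  let x' : I.H := ∑ b ∈ u, PowerSeries.C (f b) • g b
  have hx' : I.proj 0 x' = I.proj 0 x := by
    have h := congrArg (fun a : ↥A => (a : H1 (tateRep W p) (κ.layerSubgroup 0))) hf
    simp only [Submodule.coe_sum, SetLike.val_smul] at h
    rw [← h, map_sum]
    exact Finset.sum_congr rfl fun b hb => by rw [I.proj_C_smul, hg b hb]
  have hmem : x - x' ∈ TSubmodule p I.H := hα _ (by rw [map_sub, hx', sub_self])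
  obtain ⟨y, hy⟩ := (mem_TSubmodule_iff p I.H _).mp hmem
  refine ⟨y, ?_⟩
  rw [hy, sub_sub_cancel]
  exact Submodule.sum_mem _ fun b hb =>
    Submodule.smul_mem _ _ (Submodule.subset_span (Finset.mem_coe.mpr (Finset.mem_image_of_mem g hb)))

/-- **(12.2.1) for `𝐇¹_Γ(T_pW)` from a descent package**: `IwasawaH2Data W p κ γ I` carries (α)
(`IwasawaH2Data.proj_zero_eq_zero_iff_mem_TSubmodule`), so its existence makes `𝐇¹_Γ(T_pW)` finitely
generated over `Λ`. [cite: Kato2004Asterisque, §12.2 (12.2.1) (p. 220) and §14.14 (14.14.1) (p. 243)] -/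
theorem module_finite_of_nonempty_iwasawaH2Data (h : Nonempty (IwasawaH2Data W p κ γ I)) :
    Module.Finite (IwasawaAlgebra p) I.H := by
  obtain ⟨J⟩ := h
  exact I.module_finite_of_proj_zero_injective fun x hx => (J.proj_zero_eq_zero_iff_mem_TSubmodule x).mp hx

end IwasawaH1Data

/-- **The named-fact shape: (12.2.1) for every pin from (α) under the fact's binders.**  If Kato's
(14.14.1)-injectivity holds for every pin with `κ` cyclotomic and `γ` a topological generator, then
for all such data `𝐇¹_Γ(T_pW)` is a finitely generated `Λ`-module — the first clause of
`Kato2004.thm12_4`. [cite: Kato2004Asterisque, §12.2 (12.2.1) (p. 220)] -/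
theorem module_finite_iwasawaH1_of_forall_isTopGenerator
    (hα : ∀ (W : WeierstrassCurve ℚ) [W.IsElliptic] (p : ℕ) [Fact p.Prime]
      [ContinuousSMul ℤ_[p] (W.tateModule p)] (κ : ZpExtension ℚ p) (γ : absoluteGaloisGroup ℚ),
      κ.IsCyclotomic → κ.IsTopGenerator γ → ∀ (I : IwasawaH1Data W p κ γ) (x : I.H),
        I.proj 0 x = 0 → x ∈ TSubmodule p I.H)
    (W : WeierstrassCurve ℚ) [W.IsElliptic] (p : ℕ) [Fact p.Prime]
    [ContinuousSMul ℤ_[p] (W.tateModule p)] (κ : ZpExtension ℚ p) (γ : absoluteGaloisGroup ℚ)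
    (hκ : κ.IsCyclotomic) (hγ : κ.IsTopGenerator γ) (I : IwasawaH1Data W p κ γ) :
    Module.Finite (IwasawaAlgebra p) I.H :=
  I.module_finite_of_proj_zero_injective (hα W p κ γ hκ hγ I)

end Literature.NumberTheory.EllipticCurves.Kato2004

end
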